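import Summits.BirchSwinnertonDyer.Rank1Residual.X6.RankZeroCertificateClaim
import Summits.BirchSwinnertonDyer.Rank1Residual.X6.RankZeroCertificateRecords01
import Summits.BirchSwinnertonDyer.Rank1Residual.X6.RankZeroCertificateRecords02
import Summits.BirchSwinnertonDyer.Rank1Residual.X6.RankZeroCertificateRecords03
import Summits.BirchSwinnertonDyer.Rank1Residual.X6.RankZeroCertificateRecords04
import Summits.BirchSwinnertonDyer.Rank1Residual.X6.RankZeroCertificateRecords05
import Summits.BirchSwinnertonDyer.Rank1Residual.X6.RankZeroCertificateRecords06
import Summits.BirchSwinnertonDyer.Rank1Residual.X6.RankZeroCertificateRecords07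
import Summits.BirchSwinnertonDyer.Rank1Residual.X6.RankZeroCertificateRecords08
import Summits.BirchSwinnertonDyer.Rank1Residual.X6.RankZeroCertificateRecords09
import Summits.BirchSwinnertonDyer.Rank1Residual.X6.RankZeroCertificateRecords10
import Summits.BirchSwinnertonDyer.Rank1Residual.X6.RankZeroCertificateRecords11
import Summits.BirchSwinnertonDyer.Rank1Residual.X6.RankZeroCertificateRecords12
import Summits.BirchSwinnertonDyer.Rank1Residual.X6.RankZeroCertificateRecords13
import Summits.BirchSwinnertonDyer.Rank1Residual.X6.RankZeroCertificateRecords14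
import Summits.BirchSwinnertonDyer.Rank1Residual.X6.RankZeroCertificateRecords15
import Summits.BirchSwinnertonDyer.Rank1Residual.X6.RankZeroCertificateRecords16
import HarnessLib

/-!
# Class X6 ∧ analytic rank `0` — the per-class DISPLAY: all 734 certificate records of the sweep residue,
# what the kernel proves for each (`ClassX6`, the BSTW-scope witness), and `BSD(E,p)` per road modulo the claims

Cell `bsd-print-x6` (D-0131 (2) print tier, key `x6`; HOME `run/shared/lean/pub/bsd-print-x6/`), typer seat ty3.
`allRecords` = `records01 ++ … ++ records16` (files `RankZeroCertificateRecords01–16.lean`): ONE record per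
(Cremona isogeny class, prime) of the sweep S-b residue of the leaf `ClassX6 W p ∧ W.analyticRank = 0` (bsdN sweep
v4f `RESIDUE.jsonl`, entries `[p, "X6"]`; `N < 5·10⁵`): 734 pairs — `p = 3`: 621, `5`: 86, `7`: 20, `11`: 4,
`13`: 3; all of analytic rank `0`, all with `p ∣ #Ш_an` (`ord_p #Ш_an = 2` except `= 4` on 152330l1, 271726d1, 405130d1),
63 with `p ∣ ∏ c_ℓ`. Every record passes the kernel recheck (`certified_allRecords`), so for EVERY listed pair the
kernel has PROVED (no claim): the model is elliptic and globally minimal, `ClassX6 W p` (`classX6_of_mem`), and —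
every record carrying an auxiliary datum with an odd inert prime (`auxiliary_allRecords`) — the BSTW-scope witness
`BSTWScope.HasWitness W p` (`hasWitness_of_mem`). MODULO the records' `Claims` (analytic rank `0`, `#Ш_an`, `#tor`,
`∏c`: engine T = Cremona's tables, engine P = PARI/GP 2.17.2 kit job j279191, agreeing on all 734 × all fields) and the
named inputs of each road: `BSD(E,p)` for every listed pair from the printed BSTW Thm. 1.3 OPEN binder
(`bsdp_of_mem_of_BSTW13_OPEN`, prover p1's road), from the cell-verified scoped binder at `p ≥ 5`
(`bsdp_of_mem_of_thm13_scoped_OPEN`, 113 pairs), or from ANY proof of the typed lower bound (`bsdp_of_mem_of_lowerBound`,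
the socket for p2/p4). PARTITION (D-0054): leaf X6 ∧ r = 0 (K3 row A6) — types-the-object-of; closes NONE (the
binders are unrefereed-preprint hypotheses; the claims are computations). HONEST FRAMING: nothing here is a
class theorem and BSD is not proved for any pair unconditionally.

References: Cremona's tables [Cremona2006]; Silverman *AEC* VII.5.1 [SilvermanAEC2009]; Wuthrich 2014 Prop. 21 [Wuthrich2014];
Burungale–Skinner–Tian–Wan arXiv:2409.01350v2 Thm. 1.3, §10.3 (PRE, OPEN binders only) [BurungaleSkinnerTianWan2024].
-/

set_option autoImplicit false

noncomputable section

open scoped Classical MatrixGroups ModularForm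

open CongruenceSubgroup WeierstrassCurve Literature.NumberTheory.EllipticCurves
  Literature.NumberTheory.EllipticCurves.ModularForms
  Literature.NumberTheory.EllipticCurves.Rank1Residual
  Literature.NumberTheory.EllipticCurves.Rank1Residual.Typed
  Summit.BirchSwinnertonDyer.Rank1Residual.Supersingular

namespace Summit.BirchSwinnertonDyer.Rank1Residual.X6.PrintCert

/-- All 734 certificate records of the sweep residue of X6 ∧ `r_an = 0` (`N < 5·10⁵`), by `p` then `N`.
[cite: Cremona2006, Table 1 (curve data by Cremona label)] -/
def allRecords : List Record := records01 ++ records02 ++ records03 ++ records04 ++ records05 ++ records06 ++ records07 ++ records08 ++ records09 ++ records10 ++ records11 ++ records12 ++ records13 ++ records14 ++ records15 ++ records16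

/-- Every record passes the kernel recheck. [folklore] -/
theorem certified_allRecords : certified allRecords = true :=
  (certified_append (certified_append (certified_append (certified_append (certified_append (certified_append (certified_append (certified_append (certified_append (certified_append (certified_append (certified_append (certified_append (certified_append (certified_append certified_records01 certified_records02) certified_records03) certified_records04) certified_records05) certified_records06) certified_records07) certified_records08) certified_records09) certified_records10) certified_records11) certified_records12) certified_records13) certified_records14) certified_records15) certified_records16)

/-- The display has 734 records: 621 at `p = 3`, 86 at `p = 5`, 20 at `p = 7`, 4 at `p = 11`, 3 at `p = 13`. [folklore] -/
theorem count_allRecords : allRecords.length = 734 ∧ (allRecords.filter fun r => r.p = 3).length = 621 ∧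
    (allRecords.filter fun r => r.p = 5).length = 86 ∧ (allRecords.filter fun r => r.p = 7).length = 20 ∧
    (allRecords.filter fun r => r.p = 11).length = 4 ∧ (allRecords.filter fun r => r.p = 13).length = 3 := by
  decide +kernel

/-- Every record carries a BSTW §10.3 auxiliary datum with an ODD inert prime (so `hasWitness_of_check` applies to all 734). [folklore] -/
theorem auxiliary_allRecords : (allRecords.all fun r => decide (r.auxDisc ≠ 0) && decide (r.auxInert ≠ 2)) = true := by
  decide +kernel

/-- `ord_p #Ш_an ∈ {2, 4}` on the residue: `= 2` on 731 records, `= 4` exactly on 152330l1, 271726d1, 405130d1; `ord_p ∏c > 0` on 63. [folklore] -/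
theorem ordpSha_allRecords : (allRecords.all fun r => decide (r.ordpSha = 2 ∨ r.ordpSha = 4)) = true ∧
    ((allRecords.filter fun r => r.ordpSha = 4).map Record.label) = ["152330l1", "271726d1", "405130d1"] ∧
    (allRecords.filter fun r => 0 < r.ordpTam).length = 63 := by
  decide +kernel

/-- **`ClassX6 W p` for every listed pair** (kernel theorem per record; instance binders from the recheck).
[cite: SilvermanAEC2009, VII.5 Prop. 5.1(a) and (b)] -/
theorem classX6_of_mem (r : Record) (hr : r ∈ allRecords) :
    haveI := r.fact_prime_of_check (check_of_mem_of_certified certified_allRecords hr)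
    haveI := (r.elliptic_and_minimal_of_check (check_of_mem_of_certified certified_allRecords hr)).1
    haveI := (r.elliptic_and_minimal_of_check (check_of_mem_of_certified certified_allRecords hr)).2
    ClassX6 r.curve r.p :=
  classX6_of_certified certified_allRecords r hr

/-- **The BSTW-scope witness for every listed pair** (kernel theorem per record): a (ram) prime `q₀` and
`L = ℚ(√−D)` with `p` split, `q₀` inert, the other bad primes split, `(d_L, 2N) = 1`, `2` split if `2 ∤ N`, `p ∤ h_L`.
[cite: Cox2013, Thm. 2.13 and §7.B Thm. 7.7(ii)] -/
theorem hasWitness_of_mem (r : Record) (hr : r ∈ allRecords) :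
    haveI := r.fact_prime_of_check (check_of_mem_of_certified certified_allRecords hr)
    haveI := (r.elliptic_and_minimal_of_check (check_of_mem_of_certified certified_allRecords hr)).1
    haveI := (r.elliptic_and_minimal_of_check (check_of_mem_of_certified certified_allRecords hr)).2
    BSTWScope.HasWitness r.curve r.p := by
  have hc := check_of_mem_of_certified certified_allRecords hr
  have ha := List.all_eq_true.mp auxiliary_allRecords r hr
  simp only [Bool.and_eq_true, decide_eq_true_eq] at ha
  haveI := r.fact_prime_of_check hc
  haveI := (r.elliptic_and_minimal_of_check hc).1
  haveI := (r.elliptic_and_minimal_of_check hc).2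
  exact r.hasWitness_of_check hc ha.1 ha.2

/-- **PRINT road on the whole display**: IF BSTW Thm. 1.3 (printed OPEN binder, unrefereed) holds and the records'
claims hold, `BSD(E,p)` for every one of the 734 pairs (published inputs by name).
[claim: BurungaleSkinnerTianWan2024, status: under-review] [cite: Wuthrich2014, Prop. 21 (p. 400)] [cite: Miller2011LMS, §1 and Def. 1.1] -/
theorem bsdp_of_mem_of_BSTW13_OPEN (hBSTW : BurungaleSkinnerTianWan2024_thm13_OPEN)
    (hW : Wuthrich2014.sha_dvd_analyticSha) (h12 : Kobayashi2003.thm12_signedSelmerDual_finite_torsion)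
    (hKim : BDKim2013.cor315_signedCharValue_rankZero)
    (hPollack : ∀ (W : WeierstrassCurve ℚ) [W.IsElliptic] [W.IsGloballyMinimal] (p : ℕ) [Fact p.Prime]
      {N : ℕ} [NeZero N] {f : CuspForm (Gamma0 N) 2},
      pollack_exists_plusMinusPAdicLFunction (W := W) (f := f) (p := p))
    (hmod : nonempty_modularParametrizationData) (hmod' : hasEntireLFunction_rat)
    (hGZK : rank_eq_analyticRank_of_analyticRank_le_one) (hcl : Claims allRecords) (r : Record) (hr : r ∈ allRecords) :
    haveI := r.fact_prime_of_check (check_of_mem_of_certified certified_allRecords hr)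
    haveI := (r.elliptic_and_minimal_of_check (check_of_mem_of_certified certified_allRecords hr)).1
    haveI := (r.elliptic_and_minimal_of_check (check_of_mem_of_certified certified_allRecords hr)).2
    BSDp r.curve r.p :=
  bsdp_of_certified_of_claims_of_BSTW13_OPEN hBSTW hW h12 hKim hPollack hmod hmod' hGZK certified_allRecords hcl r hr

/-- **CELL-VERIFIED-SCOPE road on the display at `p ≥ 5`** (113 pairs): IF the scoped binder holds and the claims hold,
`BSD(E,p)` — the scope witness is the record's kernel theorem. [claim: BurungaleSkinnerTianWan2024, status: under-review]
[cite: Wuthrich2014, Prop. 21 (p. 400)] [cite: Miller2011LMS, §1 and Def. 1.1] -/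
theorem bsdp_of_mem_of_thm13_scoped_OPEN (hBSTW : BurungaleSkinnerTianWan2024_thm13_scoped_OPEN)
    (hW : Wuthrich2014.sha_dvd_analyticSha) (h12 : Kobayashi2003.thm12_signedSelmerDual_finite_torsion)
    (hKim : BDKim2013.cor315_signedCharValue_rankZero)
    (hPollack : ∀ (W : WeierstrassCurve ℚ) [W.IsElliptic] [W.IsGloballyMinimal] (p : ℕ) [Fact p.Prime]
      {N : ℕ} [NeZero N] {f : CuspForm (Gamma0 N) 2},
      pollack_exists_plusMinusPAdicLFunction (W := W) (f := f) (p := p))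
    (hmod : nonempty_modularParametrizationData) (hmod' : hasEntireLFunction_rat)
    (hGZK : rank_eq_analyticRank_of_analyticRank_le_one) (hcl : Claims allRecords) (r : Record) (hr : r ∈ allRecords)
    (h5 : 5 ≤ r.p) :
    haveI := r.fact_prime_of_check (check_of_mem_of_certified certified_allRecords hr)
    haveI := (r.elliptic_and_minimal_of_check (check_of_mem_of_certified certified_allRecords hr)).1
    haveI := (r.elliptic_and_minimal_of_check (check_of_mem_of_certified certified_allRecords hr)).2
    BSDp r.curve r.p := by
  have hc := check_of_mem_of_certified certified_allRecords hr
  have ha := List.all_eq_true.mp auxiliary_allRecords r hr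
  simp only [Bool.and_eq_true, decide_eq_true_eq] at ha
  haveI := r.fact_prime_of_check hc
  haveI := (r.elliptic_and_minimal_of_check hc).1
  haveI := (r.elliptic_and_minimal_of_check hc).2
  exact r.bsdp_of_thm13_scoped_OPEN hBSTW hW h12 hKim (hPollack r.curve r.p) hmod hmod' hGZK hc (hcl r hr) h5 ha.1 ha.2

/-- **The SOCKET on the display**: for every listed pair, the claims + ANY proof of `MissingLowerBoundAt` ⇒ `BSD(E,p)`
(Wuthrich Prop. 21, GZK, modularity by name). [cite: Wuthrich2014, Prop. 21 (p. 400)] [cite: Miller2011LMS, §1 and Def. 1.1] -/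
theorem bsdp_of_mem_of_lowerBound (hW : Wuthrich2014.sha_dvd_analyticSha)
    (hGZK : rank_eq_analyticRank_of_analyticRank_le_one) (hmod : hasEntireLFunction_rat) (hcl : Claims allRecords)
    (r : Record) (hr : r ∈ allRecords) (hlow : MissingLowerBoundAt r.curve r.p) :
    haveI := r.fact_prime_of_check (check_of_mem_of_certified certified_allRecords hr)
    haveI := (r.elliptic_and_minimal_of_check (check_of_mem_of_certified certified_allRecords hr)).1
    haveI := (r.elliptic_and_minimal_of_check (check_of_mem_of_certified certified_allRecords hr)).2
    BSDp r.curve r.p :=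
  bsdp_of_certified_of_claims_of_lowerBound hW hGZK hmod certified_allRecords hcl r hr hlow

end Summit.BirchSwinnertonDyer.Rank1Residual.X6.PrintCert

end
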